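import Summits.QuantumFields.BalabanUV.Beta.EriceFlowEnclosureB12AsPrintedHistoryContagionShiftFlowZeroSemigroupGellMannLowOneLoop

/-!
# Beta / EriceFlowEnclosureB12AsPrintedHistoryContagionShiftFlowZeroSemigroupVelocityWitness — ASYMPTOTIC FREEDOM IS CONTAGIOUS, part 62: «ALMOST EVERYWHERE» IS SHARP —
# a LIPSCHITZ KINK in the memory functional propagates to the Λ-coordinate: for the def-free Markov functional **`B(u) = 1 + min(u₀, a)`** (memory profile with C_m = 1,
# any θ; value 1 at the zero history; a TOY, not Bałaban's β) NO dynamical Abel function of the flow is differentiable at every coupling of the small box.  Parts 55–57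
# gave the continuous renormalization group a velocity at ALMOST every scale with no differentiability hypothesis on B; part 60 recorded that an EVERYWHERE derivative of Λ
# is what a Gell-Mann–Low equation at every scale needs.  This part shows the gap is real under the standing hypotheses (memory profile + value at zero + one AF reference
# + part 14's package): (§99, pure calculus) if a map R near g₀ is order-preserving through `R g₀ = a` and satisfies the one-step identity
# **`1∕R(g)² = 1∕g² + 1 + min(R g, a)`** near g₀, then R is NOT differentiable at g₀ (`not_differentiableAt_of_kink`: on the right of g₀ the identity reads
# `1∕g² = 1∕R² − 1 − a`, on the left `1∕g² = 1∕R² − 1 − R`; a derivative ρ of R would give the chart `1∕g²` the one-sided derivatives `−2ρ∕a³` and `−2ρ∕a³ − ρ` at g₀,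
# which must both equal `−2∕g₀³` — forcing ρ = 0 and then `2∕g₀³ = 0`); (§100) the kink functional has node U2's memory profile with C_m = 1 and the value 1 at the zero
# history (`kinkB_memoryProfile`, `kinkB_valueAtZero`, floor `kinkB_ge_one`); (§101, FOR THE FLOW of the kink functional, Λ any dynamical Abel function, part 14's package
# at e′) the renormalization step `R = φ_1` satisfies the one-step identity on ]0, e′] (`kink_step`), so for every kink position `a ∈ ]0, e′[` one backward step inside the box
# (`Λ e′ + β₀ < Λ a`): **Λ is NOT differentiable at both `φ_{−1} a` and `a`** (**`kink_not_differentiableAt_pair`** — else part 56's pin derivative would differentiate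
# `R = Λ⁻¹∘(Λ + β₀)` at `φ_{−1} a`), hence **`∃ x ∈ ]0, e′[, ¬ DifferentiableAt ℝ Λ x`** (**`kink_exists_not_differentiableAt`**) while, by part 55, Λ IS differentiable
# almost everywhere (`kink_ae_not_everywhere`): the a.e. qualifier of parts 55–58 cannot be dropped without a smoothness hypothesis on B — a derivative hypothesis shape
# for the functional (g40 NEXT-TOUCH (A⁗′), a node U2 question) is NECESSARY, not merely convenient, for the smooth theory of part 60.
# (β-flow team, prover 1 = recursion ∕ upper ∕ bare-coupling ∕ uniqueness side, unit `b2b-balaban-beta-bflow-p1`, gen 41; ROW AP-I·Uc × NODE U2 — load-bearing witness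
# of the infinitesimal renormalization group; over part 57 (`dynAbel_chart_bounds`), part 56 (`hasDerivAt_rg_pin`), part 55 (`ae_differentiableAt_abel`), part 54
# (`rg_mem_eq_of_le`, `rg_rg_neg`), part 46 (`rg_mem_eq`, `rg_natCast_eq`, `rg_strictMonoOn`), part 44 (`dynAbel_shift`), part 13 (THE solution), part 34 (`package_of_le`,
# `succ_le_of_reference_flow`), node U2's `summable_profile` ∕ `summable_weighted` BY NAME)

HONEST FRAMING (page 1 of everything the β sub-cell writes): discharging `BetaPertH` makes Bałaban's UV stability UNCONDITIONAL — a
real constructive-QFT result; it is NOT the continuum limit and NOT the Clay problem.  HONEST DEPENDENCY (cell reorg 2026-08-19,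
verbatim): «continuum YM on T⁴ ⇐ BetaPertH ∧ nine spine estimates (0/9 proved); BetaPertH ⇐ (D1) ∧ (D4) ∧ CAP+tail; G-an2-4 gates
asym, D1 and NE2/3/4.»  THIS MODULE DISCHARGES NOTHING: a def-free TOY functional `1 + min(u₀, a)` (NOT Bałaban's β, and no claim about it) run through the lineage's
own parts 13 ∕ 34 ∕ 44 ∕ 46 ∕ 54–57 BY NAME under the standing package hypotheses (kept as hypotheses of the same shape as every flow-level theorem of the row; their
joint satisfiability for this toy — node U2's contraction regime `γ < 1 − θ` with floor 1, and part 36's thresholds — is the business of a companion, not asserted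
here); [folklore] one-sided derivatives.  `ScaleShiftRate` ∕ `HistLipschitz` ∕ `FadingMemory` and [I] THEOREM 2 do not occur.  [I] = T. Bałaban, Commun. Math. Phys.
**109** (1987) 249–301 [Balaban1987RG1]: Thm 2 (0.31) p. 259 — context of the row only.

WHAT THIS FILE PROVES (0 sorry, 0 def): §99 **`not_differentiableAt_of_kink`**; §100 `kinkB_memoryProfile`, `kinkB_valueAtZero`, `kinkB_ge_one`; §101 **`kink_step`**,
**`kink_not_differentiableAt_pair`**, **`kink_exists_not_differentiableAt`**, `kink_ae_not_everywhere`.  NOT CLAIMED: that Bałaban's β has or lacks a kink;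
anything about Bałaban's β; `BetaPertH`; continuum; Clay.
-/

namespace Summit.QuantumFields.BalabanUV.Beta.EriceFlowEnclosureB12AsPrintedHistoryContagionShiftFlowZeroSemigroupVelocityWitness

open Filter Topology Set Function MeasureTheory
open Literature.MathematicalPhysics.QuantumFieldTheory.Balaban1983to89
open Literature.MathematicalPhysics.QuantumFieldTheory.Balaban1983to89.T4BetaStationary (SeqBox MemoryProfile summable_profile)
open Literature.MathematicalPhysics.QuantumFieldTheory.Balaban1983to89.T4BetaStationary.Probes (summable_weighted)
open Literature.MathematicalPhysics.QuantumFieldTheory.Balaban1983to89.T4BetaFlowWellPosed (MemFlow solution)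
open Summit.QuantumFields.BalabanUV.Beta.EriceFlowEnclosureB12AsPrintedHistoryContagionShiftFlowPicardLimit (memFlow_solution_of_reference)
open Summit.QuantumFields.BalabanUV.Beta.EriceFlowEnclosureB12AsPrintedHistoryContagionShiftFlowZeroOffset (package_of_le succ_le_of_reference_flow)
open Summit.QuantumFields.BalabanUV.Beta.EriceFlowEnclosureB12AsPrintedHistoryContagionShiftFlowZeroIsometry (dynAbel_shift)
open Summit.QuantumFields.BalabanUV.Beta.EriceFlowEnclosureB12AsPrintedHistoryContagionShiftFlowZeroSemigroup (rg_mem_eq rg_natCast_eq rg_strictMonoOn)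
open Summit.QuantumFields.BalabanUV.Beta.EriceFlowEnclosureB12AsPrintedHistoryContagionShiftFlowZeroSemigroupBackward (rg_mem_eq_of_le rg_rg_neg)
open Summit.QuantumFields.BalabanUV.Beta.EriceFlowEnclosureB12AsPrintedHistoryContagionShiftFlowZeroSemigroupVelocity (ae_differentiableAt_abel)
open Summit.QuantumFields.BalabanUV.Beta.EriceFlowEnclosureB12AsPrintedHistoryContagionShiftFlowZeroSemigroupGellMannLow (hasDerivAt_rg_pin)
open Summit.QuantumFields.BalabanUV.Beta.EriceFlowEnclosureB12AsPrintedHistoryContagionShiftFlowZeroSemigroupGellMannLowOneLoop (dynAbel_chart_bounds)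

noncomputable section

/-! ## §99 Pure calculus: a kink in the one-step identity forbids a derivative -/

/-- **A KINK IN THE ONE-STEP IDENTITY FORBIDS A DERIVATIVE.**  Let `R : ℝ → ℝ`, `g₀ > 0`, `a > 0` with `R g₀ = a`, R order-preserving through g₀ (`g ≤ g₀ ⟹ R g ≤ a`,
`g₀ ≤ g ⟹ a ≤ R g` near g₀) and, near g₀, **`1∕R(g)² = 1∕g² + 1 + min(R g, a)`**.  THEN R is NOT differentiable at g₀: to the right the identity reads `1∕g² = 1∕R² − 1 − a`,
to the left `1∕g² = 1∕R² − 1 − R`; a derivative ρ of R at g₀ would give the chart `g ↦ 1∕g²` the one-sided derivatives `−2ρ∕a³` (right) and `−2ρ∕a³ − ρ` (left) at g₀,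
both equal to `−2∕g₀³` by uniqueness of one-sided derivatives — so ρ = 0 and `2∕g₀³ = 0`, absurd. [folklore] -/
theorem not_differentiableAt_of_kink {R : ℝ → ℝ} {g₀ a : ℝ} (hg₀ : 0 < g₀) (ha : 0 < a) (hRa : R g₀ = a)
    (hmono : ∀ᶠ g in 𝓝 g₀, (g ≤ g₀ → R g ≤ a) ∧ (g₀ ≤ g → a ≤ R g))
    (hstep : ∀ᶠ g in 𝓝 g₀, 1 / R g ^ 2 = 1 / g ^ 2 + 1 + min (R g) a) : ¬ DifferentiableAt ℝ R g₀ := by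
  intro hdiff
  set ρ := deriv R g₀ with hρdef
  have hR : HasDerivAt R ρ g₀ := hdiff.hasDerivAt
  have hRne : R g₀ ≠ 0 := by rw [hRa]; exact ha.ne'
  -- derivative of `1∕R²` at g₀
  have hinvsq : HasDerivAt (fun g => 1 / R g ^ 2) (-2 * ρ / a ^ 3) g₀ := by
    have h := (hR.pow 2).inv (pow_ne_zero 2 hRne)
    have h' : HasDerivAt (fun g => 1 / R g ^ 2) (-(↑(2 : ℕ) * R g₀ ^ (2 - 1) * ρ) / (R g₀ ^ 2) ^ 2) g₀ :=
      h.congr_of_eventuallyEq (Eventually.of_forall fun y => by simp [one_div])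
    refine h'.congr_deriv ?_
    rw [hRa]
    push_cast
    field_simp
  -- derivative of the chart `1∕g²` at g₀
  have hchart : HasDerivAt (fun g : ℝ => 1 / g ^ 2) (-2 / g₀ ^ 3) g₀ := by
    have h1 := (hasDerivAt_pow 2 g₀).inv (pow_ne_zero 2 hg₀.ne')
    have h2 : HasDerivAt (fun y : ℝ => 1 / y ^ 2) (-(↑(2 : ℕ) * g₀ ^ (2 - 1)) / (g₀ ^ 2) ^ 2) g₀ :=
      h1.congr_of_eventuallyEq (Eventually.of_forall fun y => by simp [one_div])
    refine h2.congr_deriv ?_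
    push_cast
    field_simp
  have hstep0 : 1 / R g₀ ^ 2 = 1 / g₀ ^ 2 + 1 + min (R g₀) a := hstep.self_of_nhds
  rw [hRa, min_self] at hstep0
  -- RIGHT of g₀: `1∕g² = 1∕R g² − 1 − a`
  have hright : HasDerivWithinAt (fun g : ℝ => 1 / g ^ 2) (-2 * ρ / a ^ 3) (Ici g₀) g₀ := by
    have hF : HasDerivAt (fun g => 1 / R g ^ 2 - 1 - a) (-2 * ρ / a ^ 3) g₀ := (hinvsq.sub_const 1).sub_const a
    refine hF.hasDerivWithinAt.congr_of_eventuallyEq ?_ ?_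
    · filter_upwards [nhdsWithin_le_nhds (hmono.and hstep), self_mem_nhdsWithin] with g hg hgI
      obtain ⟨hm, hs⟩ := hg
      have hRg : a ≤ R g := hm.2 hgI
      rw [min_eq_right hRg] at hs
      linarith
    · rw [hRa]; linarith
  -- LEFT of g₀: `1∕g² = 1∕R g² − 1 − R g`
  have hleft : HasDerivWithinAt (fun g : ℝ => 1 / g ^ 2) (-2 * ρ / a ^ 3 - ρ) (Iic g₀) g₀ := by
    have hF : HasDerivAt (fun g => 1 / R g ^ 2 - 1 - R g) (-2 * ρ / a ^ 3 - ρ) g₀ := (hinvsq.sub_const 1).sub hR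
    refine hF.hasDerivWithinAt.congr_of_eventuallyEq ?_ ?_
    · filter_upwards [nhdsWithin_le_nhds (hmono.and hstep), self_mem_nhdsWithin] with g hg hgI
      obtain ⟨hm, hs⟩ := hg
      have hRg : R g ≤ a := hm.1 hgI
      rw [min_eq_left hRg] at hs
      linarith
    · rw [hRa]; linarith
  -- one-sided derivatives of the chart are unique
  have e1 : -2 * ρ / a ^ 3 = -2 / g₀ ^ 3 :=
    UniqueDiffWithinAt.eq_deriv (Ici g₀) (uniqueDiffOn_Ici g₀ g₀ self_mem_Ici) hright hchart.hasDerivWithinAt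
  have e2 : -2 * ρ / a ^ 3 - ρ = -2 / g₀ ^ 3 :=
    UniqueDiffWithinAt.eq_deriv (Iic g₀) (uniqueDiffOn_Iic g₀ g₀ self_mem_Iic) hleft hchart.hasDerivWithinAt
  have hρ : ρ = 0 := by linarith
  rw [hρ, mul_zero, zero_div] at e1
  have : (0 : ℝ) < 2 / g₀ ^ 3 := by positivity
  have : -2 / g₀ ^ 3 = -(2 / g₀ ^ 3) := by ring
  linarith

/-! ## §100 The kink functional `B(u) = 1 + min(u₀, a)` has node U2's memory profile and the value 1 at the zero history -/

/-- The kink functional has memory profile `(C_m, θ) = (1, θ)` for every `0 ≤ θ < 1` (it is 1-Lipschitz in the last coupling, and the weighted sum dominates its first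
term). [folklore] -/
theorem kinkB_memoryProfile {θ γ a : ℝ} (hθ0 : 0 ≤ θ) (hθ1 : θ < 1) : MemoryProfile 1 θ γ (fun u : ℕ → ℝ => 1 + min (u 0) a) := by
  intro h h' hh hh'
  have hs := summable_profile hθ0 hθ1 hh hh'
  have h0le : θ ^ 0 * |h 0 - h' 0| ≤ ∑' j, θ ^ j * |h j - h' j| :=
    hs.le_tsum 0 (fun j _ => mul_nonneg (pow_nonneg hθ0 j) (abs_nonneg _))
  rw [pow_zero, one_mul] at h0le
  have hmin : |min (h 0) a - min (h' 0) a| ≤ |h 0 - h' 0| := abs_min_sub_min_le_max _ _ _ _ |>.trans (by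
    rw [max_le_iff]; exact ⟨le_rfl, by simp⟩)
  calc |1 + min (h 0) a - (1 + min (h' 0) a)| = |min (h 0) a - min (h' 0) a| := by ring_nf
    _ ≤ |h 0 - h' 0| := hmin
    _ ≤ 1 * ∑' j, θ ^ j * |h j - h' j| := by rw [one_mul]; exact h0le

/-- The kink functional has THE VALUE 1 AT THE ZERO HISTORY in part 32's letter shape: `|B(u) − 1| ≤ 1·Σ_j θ^j u_j` on box histories (for `a ≥ 0`). [folklore] -/
theorem kinkB_valueAtZero {θ γ a : ℝ} (hθ0 : 0 ≤ θ) (hθ1 : θ < 1) (ha : 0 ≤ a) :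
    ∀ u : ℕ → ℝ, SeqBox γ u → |(fun u : ℕ → ℝ => 1 + min (u 0) a) u - 1| ≤ 1 * ∑' j, θ ^ j * u j := by
  intro u hu
  have hs := summable_weighted hθ0 hθ1 hu
  have h0le : θ ^ 0 * u 0 ≤ ∑' j, θ ^ j * u j := hs.le_tsum 0 (fun j _ => mul_nonneg (pow_nonneg hθ0 j) (hu j).1.le)
  rw [pow_zero, one_mul] at h0le
  have hmin0 : 0 ≤ min (u 0) a := le_min (hu 0).1.le ha
  have hmin1 : min (u 0) a ≤ u 0 := min_le_left _ _
  show |1 + min (u 0) a - 1| ≤ 1 * ∑' j, θ ^ j * u j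
  rw [show 1 + min (u 0) a - 1 = min (u 0) a by ring, abs_of_nonneg hmin0, one_mul]
  exact hmin1.trans h0le

/-- The kink functional is FLOORED BY 1 on every box (for `a ≥ 0`): node U2's original contraction regime applies on every box with `γ < 1 − θ`. [folklore] -/
theorem kinkB_ge_one {γ a : ℝ} (ha : 0 ≤ a) : ∀ u : ℕ → ℝ, SeqBox γ u → (1 : ℝ) ≤ (fun u : ℕ → ℝ => 1 + min (u 0) a) u := by
  intro u hu
  show (1 : ℝ) ≤ 1 + min (u 0) a
  linarith [le_min (hu 0).1.le ha]

/-! ## §101 For the flow of the kink functional: the renormalization step has the kink, so Λ is not differentiable everywhere -/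

/-- **THE ONE-STEP IDENTITY OF THE KINK FLOW**: kink functional with memory profile `(C_m, θ)` on ]0, γ]^ℕ and value-at-zero letter β₀; ONE AF reference t; part 14's
package at the reference pin e′; Λ any dynamical Abel function, strictly antitone on ]0, e′] onto `[Λ e′, ∞[`, β₀ ≥ 0.  THEN for every `g ∈ ]0, e′]` the renormalization
step `R g = φ_1 g` satisfies **`1∕R(g)² = 1∕g² + 1 + min(R g, a)`** — the flow equation at the first step, the Markov functional reading only the new coupling.
[folklore] -/
theorem kink_step {Cm θ γ β₀ bs ta gs e' a : ℝ} {t : ℕ → ℝ} {c : ℕ → ℝ} {Λ : ℝ → ℝ}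
    (hB : MemoryProfile Cm θ γ (fun u : ℕ → ℝ => 1 + min (u 0) a)) (hCm : 0 ≤ Cm) (hθ0 : 0 ≤ θ) (hθ1 : θ < 1) (hbs : 0 < bs) (hta : 0 < ta)
    (h0 : ∀ u : ℕ → ℝ, SeqBox γ u → |(fun u : ℕ → ℝ => 1 + min (u 0) a) u - β₀| ≤ Cm * ∑' j, θ ^ j * u j)
    (hts : SeqBox γ t) (htf : MemFlow (fun u : ℕ → ℝ => 1 + min (u 0) a) gs t) (hprof : ∀ m : ℕ, 1 / ta ^ 2 + bs * (m : ℝ) ≤ 1 / (t m) ^ 2)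
    (hΛ : ∀ e ∈ Ioc (0 : ℝ) e', ∀ h : ℕ → ℝ, SeqBox γ h → MemFlow (fun u : ℕ → ℝ => 1 + min (u 0) a) e h →
      Tendsto (fun n => 1 / h n ^ 2 - c n) atTop (𝓝 (Λ e)))
    (hanti : StrictAntiOn Λ (Ioc 0 e')) (honto : ∀ y : ℝ, Λ e' ≤ y → ∃ x ∈ Ioc (0 : ℝ) e', Λ x = y) (hβ₀ : 0 ≤ β₀)
    (h2e' : 2 * e' ≤ γ)
    (hs1 : 4 * Cm * e' ≤ bs * (1 - θ))
    (hs2 : e' ^ 2 * (1 / gs ^ 2 + Cm * γ / (1 - θ) ^ 2 + (2 * Cm / ((1 - θ) * bs)) ^ 2) ≤ 3 / 4)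
    (hs4 : 64 * Cm * e' ^ 3 ≤ (1 - θ) ^ 2) (hs5 : Cm * (8 * e' ^ 3 + 16 * e' / bs) ≤ (1 - θ) / 4)
    {g : ℝ} (hg : g ∈ Ioc (0 : ℝ) e') :
    1 / invFunOn Λ (Ioc 0 e') (Λ g + 1 * β₀) ^ 2 = 1 / g ^ 2 + 1 + min (invFunOn Λ (Ioc 0 e') (Λ g + 1 * β₀)) a := by
  have hγ : 0 ≤ γ := by linarith [hg.1, hg.2]
  obtain ⟨p1, p2, p4, -⟩ := package_of_le hCm hθ1 hbs hγ hg.1 hg.2 hs1 hs2 hs4 hs5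
  obtain ⟨hhs, hhf, -, -⟩ := memFlow_solution_of_reference hB hCm hθ0 hθ1 hbs hta hts htf hprof hg.1 (by linarith [hg.2]) p1 p2 p4
  set h := solution (fun u : ℕ → ℝ => 1 + min (u 0) a) g with hhdef
  have habel : ∀ k : ℕ, Λ (h k) = Λ g + (k : ℝ) * β₀ := fun k =>
    dynAbel_shift hB hCm hθ0 hθ1 hbs hta h0 hts htf hprof hΛ hg hhs hhf p1 p2 k
  have hkmem : ∀ k, h k ∈ Ioc (0 : ℝ) e' := fun k =>
    ⟨(hhs k).1, (succ_le_of_reference_flow hB hCm hθ0 hθ1 hbs hta h0 hts htf hprof hhs hhf p1 p2 k).2.2.trans hg.2⟩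
  have hR : invFunOn Λ (Ioc 0 e') (Λ g + 1 * β₀) = h 1 := by
    have := rg_natCast_eq hanti honto hβ₀ hg hkmem habel 1
    simpa using this
  rw [hR]
  have hstep := hhf.2 0
  rw [zero_add, hhf.1] at hstep
  rw [hstep]
  simp only [add_zero]
  ring

/-- **NO DYNAMICAL ABEL FUNCTION OF THE KINK FLOW IS DIFFERENTIABLE AT BOTH `φ_{−1} a` AND `a`.**  In the setting of `kink_step` with β₀ > 0 (the value-at-zero letter; the
chart bounds of part 57 are available), let the kink position `a` lie in ]0, e′[ one backward step inside the box: `Λ e′ + β₀ < Λ a`.  THEN with `g₀ := φ_{−1} a ∈ ]0, e′[`: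
**`¬(DifferentiableAt ℝ Λ g₀ ∧ DifferentiableAt ℝ Λ a)`** — otherwise part 56's pin derivative makes the renormalization step `R = φ_1 = Λ⁻¹∘(Λ + β₀)` differentiable at
g₀, while R has the kink of §99 there (`R g₀ = a`, R increasing, one-step identity). [folklore] -/
theorem kink_not_differentiableAt_pair {Cm θ γ β₀ bs ta gs e' a : ℝ} {t : ℕ → ℝ} {c : ℕ → ℝ} {Λ : ℝ → ℝ}
    (hB : MemoryProfile Cm θ γ (fun u : ℕ → ℝ => 1 + min (u 0) a)) (hCm : 0 ≤ Cm) (hθ0 : 0 ≤ θ) (hθ1 : θ < 1) (hbs : 0 < bs) (hta : 0 < ta)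
    (h0 : ∀ u : ℕ → ℝ, SeqBox γ u → |(fun u : ℕ → ℝ => 1 + min (u 0) a) u - β₀| ≤ Cm * ∑' j, θ ^ j * u j)
    (hts : SeqBox γ t) (htf : MemFlow (fun u : ℕ → ℝ => 1 + min (u 0) a) gs t) (hprof : ∀ m : ℕ, 1 / ta ^ 2 + bs * (m : ℝ) ≤ 1 / (t m) ^ 2)
    (hΛ : ∀ e ∈ Ioc (0 : ℝ) e', ∀ h : ℕ → ℝ, SeqBox γ h → MemFlow (fun u : ℕ → ℝ => 1 + min (u 0) a) e h →
      Tendsto (fun n => 1 / h n ^ 2 - c n) atTop (𝓝 (Λ e)))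
    (hanti : StrictAntiOn Λ (Ioc 0 e')) (honto : ∀ y : ℝ, Λ e' ≤ y → ∃ x ∈ Ioc (0 : ℝ) e', Λ x = y) (hβ₀ : 0 < β₀)
    (h2e' : 2 * e' ≤ γ)
    (hs1 : 4 * Cm * e' ≤ bs * (1 - θ))
    (hs2 : e' ^ 2 * (1 / gs ^ 2 + Cm * γ / (1 - θ) ^ 2 + (2 * Cm / ((1 - θ) * bs)) ^ 2) ≤ 3 / 4)
    (hs4 : 64 * Cm * e' ^ 3 ≤ (1 - θ) ^ 2) (hs5 : Cm * (8 * e' ^ 3 + 16 * e' / bs) ≤ (1 - θ) / 4)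
    (ha : a ∈ Ioo (0 : ℝ) e') (hdeep : Λ e' + β₀ < Λ a) :
    invFunOn Λ (Ioc 0 e') (Λ a + -1 * β₀) ∈ Ioo (0 : ℝ) e' ∧
      ¬ (DifferentiableAt ℝ Λ (invFunOn Λ (Ioc 0 e') (Λ a + -1 * β₀)) ∧ DifferentiableAt ℝ Λ a) := by
  have hamem : a ∈ Ioc (0 : ℝ) e' := ⟨ha.1, ha.2.le⟩
  have hbounds := dynAbel_chart_bounds hB hCm hθ0 hθ1 hbs hta hts htf hprof hΛ h2e' hs1 hs2 hs4 hs5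
  -- the backward point g₀ = φ_{−1} a
  have hle : Λ e' ≤ Λ a + -1 * β₀ := by linarith
  obtain ⟨hg₀mem, hΛg₀⟩ := rg_mem_eq_of_le honto hle
  set g₀ := invFunOn Λ (Ioc 0 e') (Λ a + -1 * β₀) with hg₀def
  have hg₀lt : g₀ < e' := by
    rcases hg₀mem.2.lt_or_eq with h | h
    · exact h
    · exfalso; rw [h] at hΛg₀; linarith
  have hg₀ : g₀ ∈ Ioo (0 : ℝ) e' := ⟨hg₀mem.1, hg₀lt⟩
  refine ⟨hg₀, fun ⟨hd₀, hda⟩ => ?_⟩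
  -- R = φ_1 and R g₀ = a
  have hRa : invFunOn Λ (Ioc 0 e') (Λ g₀ + 1 * β₀) = a := rg_rg_neg hanti honto hamem hle
  have hgs : Λ e' < Λ g₀ + 1 * β₀ := by rw [hΛg₀]; linarith [hanti hamem ⟨ha.1.trans ha.2, le_rfl⟩ ha.2]
  -- part 56: R is differentiable at g₀
  have hRdiff : DifferentiableAt ℝ (fun g' : ℝ => invFunOn Λ (Ioc 0 e') (Λ g' + 1 * β₀)) g₀ := by
    have hD : HasDerivAt Λ (deriv Λ a) (invFunOn Λ (Ioc 0 e') (Λ g₀ + 1 * β₀)) := by rw [hRa]; exact hda.hasDerivAt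
    exact (hasDerivAt_rg_pin hanti honto hβ₀ hbounds hgs hd₀.hasDerivAt hD).differentiableAt
  -- §99: R is NOT differentiable at g₀
  refine not_differentiableAt_of_kink hg₀.1 ha.1 hRa ?_ ?_ hRdiff
  · have hnb : Ioo (0 : ℝ) e' ∈ 𝓝 g₀ := Ioo_mem_nhds hg₀.1 hg₀.2
    filter_upwards [hnb] with g hg
    have hgmem : g ∈ Ioc (0 : ℝ) e' := ⟨hg.1, hg.2.le⟩
    have hmono := (rg_strictMonoOn hanti honto hβ₀.le zero_le_one (s := 1)).monotoneOn
    constructor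
    · intro hle'
      rw [← hRa]
      exact hmono hgmem hg₀mem hle'
    · intro hle'
      rw [← hRa]
      exact hmono hg₀mem hgmem hle'
  · have hnb : Ioo (0 : ℝ) e' ∈ 𝓝 g₀ := Ioo_mem_nhds hg₀.1 hg₀.2
    filter_upwards [hnb] with g hg
    exact kink_step hB hCm hθ0 hθ1 hbs hta h0 hts htf hprof hΛ hanti honto hβ₀.le h2e' hs1 hs2 hs4 hs5 ⟨hg.1, hg.2.le⟩

/-- **«ALMOST EVERYWHERE» IS SHARP**: in the setting of `kink_not_differentiableAt_pair`, **there is a coupling `x ∈ ]0, e′[` at which Λ is NOT differentiable** — for a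
functional with node U2's memory profile (C_m = 1) and a value at the zero history, the Λ-coordinate of the flow need not be differentiable everywhere: the a.e.
qualifier of parts 55–58 cannot be dropped without a smoothness hypothesis on B. [folklore] -/
theorem kink_exists_not_differentiableAt {Cm θ γ β₀ bs ta gs e' a : ℝ} {t : ℕ → ℝ} {c : ℕ → ℝ} {Λ : ℝ → ℝ}
    (hB : MemoryProfile Cm θ γ (fun u : ℕ → ℝ => 1 + min (u 0) a)) (hCm : 0 ≤ Cm) (hθ0 : 0 ≤ θ) (hθ1 : θ < 1) (hbs : 0 < bs) (hta : 0 < ta)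
    (h0 : ∀ u : ℕ → ℝ, SeqBox γ u → |(fun u : ℕ → ℝ => 1 + min (u 0) a) u - β₀| ≤ Cm * ∑' j, θ ^ j * u j)
    (hts : SeqBox γ t) (htf : MemFlow (fun u : ℕ → ℝ => 1 + min (u 0) a) gs t) (hprof : ∀ m : ℕ, 1 / ta ^ 2 + bs * (m : ℝ) ≤ 1 / (t m) ^ 2)
    (hΛ : ∀ e ∈ Ioc (0 : ℝ) e', ∀ h : ℕ → ℝ, SeqBox γ h → MemFlow (fun u : ℕ → ℝ => 1 + min (u 0) a) e h →
      Tendsto (fun n => 1 / h n ^ 2 - c n) atTop (𝓝 (Λ e)))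
    (hanti : StrictAntiOn Λ (Ioc 0 e')) (honto : ∀ y : ℝ, Λ e' ≤ y → ∃ x ∈ Ioc (0 : ℝ) e', Λ x = y) (hβ₀ : 0 < β₀)
    (h2e' : 2 * e' ≤ γ)
    (hs1 : 4 * Cm * e' ≤ bs * (1 - θ))
    (hs2 : e' ^ 2 * (1 / gs ^ 2 + Cm * γ / (1 - θ) ^ 2 + (2 * Cm / ((1 - θ) * bs)) ^ 2) ≤ 3 / 4)
    (hs4 : 64 * Cm * e' ^ 3 ≤ (1 - θ) ^ 2) (hs5 : Cm * (8 * e' ^ 3 + 16 * e' / bs) ≤ (1 - θ) / 4)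
    (ha : a ∈ Ioo (0 : ℝ) e') (hdeep : Λ e' + β₀ < Λ a) :
    ∃ x ∈ Ioo (0 : ℝ) e', ¬ DifferentiableAt ℝ Λ x := by
  obtain ⟨hg₀, hnot⟩ := kink_not_differentiableAt_pair hB hCm hθ0 hθ1 hbs hta h0 hts htf hprof hΛ hanti honto hβ₀ h2e' hs1 hs2 hs4 hs5 ha hdeep
  by_cases hd₀ : DifferentiableAt ℝ Λ (invFunOn Λ (Ioc 0 e') (Λ a + -1 * β₀))
  · exact ⟨a, ha, fun hda => hnot ⟨hd₀, hda⟩⟩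
  · exact ⟨_, hg₀, hd₀⟩

/-- **ALMOST EVERYWHERE, NOT EVERYWHERE**: in the same setting, Λ is differentiable at Lebesgue-a.e. coupling of ]0, e′[ (part 55) AND fails to be differentiable at some
coupling of ]0, e′[. [folklore] -/
theorem kink_ae_not_everywhere {Cm θ γ β₀ bs ta gs e' a : ℝ} {t : ℕ → ℝ} {c : ℕ → ℝ} {Λ : ℝ → ℝ}
    (hB : MemoryProfile Cm θ γ (fun u : ℕ → ℝ => 1 + min (u 0) a)) (hCm : 0 ≤ Cm) (hθ0 : 0 ≤ θ) (hθ1 : θ < 1) (hbs : 0 < bs) (hta : 0 < ta)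
    (h0 : ∀ u : ℕ → ℝ, SeqBox γ u → |(fun u : ℕ → ℝ => 1 + min (u 0) a) u - β₀| ≤ Cm * ∑' j, θ ^ j * u j)
    (hts : SeqBox γ t) (htf : MemFlow (fun u : ℕ → ℝ => 1 + min (u 0) a) gs t) (hprof : ∀ m : ℕ, 1 / ta ^ 2 + bs * (m : ℝ) ≤ 1 / (t m) ^ 2)
    (hΛ : ∀ e ∈ Ioc (0 : ℝ) e', ∀ h : ℕ → ℝ, SeqBox γ h → MemFlow (fun u : ℕ → ℝ => 1 + min (u 0) a) e h →
      Tendsto (fun n => 1 / h n ^ 2 - c n) atTop (𝓝 (Λ e)))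
    (hanti : StrictAntiOn Λ (Ioc 0 e')) (honto : ∀ y : ℝ, Λ e' ≤ y → ∃ x ∈ Ioc (0 : ℝ) e', Λ x = y) (hβ₀ : 0 < β₀)
    (h2e' : 2 * e' ≤ γ)
    (hs1 : 4 * Cm * e' ≤ bs * (1 - θ))
    (hs2 : e' ^ 2 * (1 / gs ^ 2 + Cm * γ / (1 - θ) ^ 2 + (2 * Cm / ((1 - θ) * bs)) ^ 2) ≤ 3 / 4)
    (hs4 : 64 * Cm * e' ^ 3 ≤ (1 - θ) ^ 2) (hs5 : Cm * (8 * e' ^ 3 + 16 * e' / bs) ≤ (1 - θ) / 4)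
    (ha : a ∈ Ioo (0 : ℝ) e') (hdeep : Λ e' + β₀ < Λ a) :
    (∀ᵐ x, x ∈ Ioo (0 : ℝ) e' → DifferentiableAt ℝ Λ x) ∧ ∃ x ∈ Ioo (0 : ℝ) e', ¬ DifferentiableAt ℝ Λ x :=
  ⟨ae_differentiableAt_abel hanti,
    kink_exists_not_differentiableAt hB hCm hθ0 hθ1 hbs hta h0 hts htf hprof hΛ hanti honto hβ₀ h2e' hs1 hs2 hs4 hs5 ha hdeep⟩

end

end Summit.QuantumFields.BalabanUV.Beta.EriceFlowEnclosureB12AsPrintedHistoryContagionShiftFlowZeroSemigroupVelocityWitness
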